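import Summits.HodgeConjecture.HodgeConjecture.Theorems.F0P3HodgeTypeRigidOfArchRigid
import Summits.HodgeConjecture.HodgeConjecture.Theorems.F0P3HodgeTypeRigidDiag
import Summits.HodgeConjecture.HodgeConjecture.Theorems.F0P3ValueMapHeads
import Literature.NumberTheory.Rogawski1990.CohArchComponentRigid
import HarnessLib

/-!
# Crux `H413`, rung-1 line `F0_U3LettersRung1` — the BY-NAME CLOSER of `stub_E2p` (letter E2′ `Rogawski1990.hodgeTypeRigid`) from
# letter β ★ `Rogawski1990.cohArchComponentRigid` and `StubF1aCM`; and E2′₀ OUTRIGHT modulo `StubF1aCM`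

Cell hodgecm-mathlib, FLOOR 0; crux item H413 = stmt-HodgeConjecture-24833; rung-1 line `Cruxes/H413/Lines/F0_U3LettersRung1.lean`
(contract v3 ∕ v4: `stub_E2p : Rogawski1990.hodgeTypeRigid`, `StubF1aCM` = F1a at the CM pin for `P` of holomorphic OR antiholomorphic
cotangent type; F0P3-plan (g2) ruling 2026-08-31T01:15:56Z (2): «β = THE rung-2 statement under `stub_E2p`»).  PROOF lane (no `def`); author
F0P3-p03 (g3).  Pure composition of ★ tree theorems:
* `hodgeTypeRigid_of_beta (hβ : cohArchComponentRigid) (hF1a : <StubF1aCM text>) : hodgeTypeRigid` := ★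
  `F0P3HodgeTypeRigidOfArchRigid.hodgeTypeRigid_of_cohArchComponentRigid hβ (hol λ) (antihol λ) hVal_hol hVal_antihol` — β ★ p800729
  (`Literature/NumberTheory/Rogawski1990/CohArchComponentRigid.lean`, F0P3-p04 (g3)), the value-map heads ★ `F0P3ValueMapHeads.hVal_hol` ∕
  `hVal_antihol` (over B1′ ★ `F0P3CotangentFormValueMap` ∕ `…Antihol`, F0P3-p01 (g3)).  Line fold: `stub_E2p := hodgeTypeRigid_of_beta β stub_F1a_cm`
  (once β is a line stub) — the debt SWAP E2′ → β (E2′ dossier `F0/P3/p03/E2PRIME-RUNG2.md` §2; honest: β is Rogawski-deep, the gain is currency).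
* `not_isHol_isAntihol_of_F1a (hF1a : <StubF1aCM text>)` — E2′₀ («no discrete `P` of `U(H)` is of both holomorphic and antiholomorphic cotangent
  type at `ι`») modulo F1a ONLY (no β): ★ `F0P3HodgeTypeRigidDiag.not_isHol_isAntihol_of_valueMaps` ∘ `hVal_hol` ∘ `hVal_antihol`.
References: [Rogawski1990] Thm. 13.3.6 (c), Thm. 13.3.5, §14.6 Thm. 14.6.4, §12.3 p. 174, Prop. 15.2.1, §15.3 ¶1; [BorelWallach2000] VI 4.11;
[FlathCorvallis1979] Thm. 3.  HONEST LABEL: HC_CM is proved only modulo the printed citations until rung 0 closes.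
-/

-- Mathlib idiom (as in `GKModules`, ★ S0∕S2∕S3, ★ B1′): commutator bracket on `Module.End`
attribute [local instance 100] LieRing.ofAssociativeRing

set_option autoImplicit false
set_option linter.dupNamespace false

noncomputable section

namespace Summit.HodgeConjecture.HodgeConjecture.Cruxes.H413.F0P3StubE2pFold

open NumberField NumberField.InfinitePlace MeasureTheory
open scoped Matrix MatrixGroups ComplexOrder
open Literature.RepresentationTheory.BorelWallach2000
open Literature.NumberTheory.Automorphic Literature.NumberTheory.Automorphic.UnitaryGroup
open Literature.NumberTheory.Automorphic.UnitaryGroup.CotangentForms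
open Literature.RepresentationTheory.KonnoKonno2007 Literature.RepresentationTheory.KonnoKonno2007.RealDualPair
open Literature.RepresentationTheory.KonnoKonno2007.RealDualPair.UForm
open Summit.HodgeConjecture.HodgeConjecture.Cruxes.H413.F0P3HodgeTypeRigidOfArchRigid
open Summit.HodgeConjecture.HodgeConjecture.Cruxes.H413.F0P3HodgeTypeRigidDiag
open Summit.HodgeConjecture.HodgeConjecture.Cruxes.H413.F0P3ValueMapHeads

/-- **`stub_E2p` CLOSER: letter E2′ `hodgeTypeRigid` from letter β `cohArchComponentRigid` and `StubF1aCM`** (F1a at the CM pin for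
hol-∕antihol-type `P`), through ★ `hodgeTypeRigid_of_cohArchComponentRigid` fed with the ★ value-map heads `hVal_hol` ∕ `hVal_antihol`.
Line fold: `stub_E2p := hodgeTypeRigid_of_beta β stub_F1a_cm`. [cite: Rogawski1990, Thm. 13.3.6 (c); Thm. 13.3.5; §14.6 Thm. 14.6.4; §12.3 p. 174;
Prop. 15.2.1; §15.3 ¶1] [cite: BorelWallach2000, VI Thm. 4.11] [cite: FlathCorvallis1979, Thm. 3] -/
theorem hodgeTypeRigid_of_beta (hβ : Literature.NumberTheory.Rogawski1990.cohArchComponentRigid)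
    (hF1a : ∀ (L : Type) [Field L] [NumberField L] [IsCMField L] (ι : L →+* ℂ) (H : Matrix (Fin 3) (Fin 3) L) (T : GL (Fin 3) ℂ)
      (hT : (T : Matrix (Fin 3) (Fin 3) ℂ)ᴴ * H.map ι * (T : Matrix (Fin 3) (Fin 3) ℂ) = Literature.Geometry.ComplexHyperbolic.BallModel.J)
      (μ : Measure (adelicGroupData (↥(maximalRealSubfield L)) L (IsCMField.complexConj L) 3 H).automorphicQuotient)
      [(adelicGroupData (↥(maximalRealSubfield L)) L (IsCMField.complexConj L) 3 H).IsAutomorphicMeasure μ]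
      (P : DiscreteAutomorphicRep (adelicGroupData (↥(maximalRealSubfield L)) L (IsCMField.complexConj L) 3 H) μ),
      (P.IsHolCotangentAt (cmArchSection L ι H T hT) (cmCompactFactor L ι H T hT) ∨
        P.IsAntiholCotangentAt (cmArchSection L ι H T hT) (cmCompactFactor L ι H T hT)) →
      P.ArchIsotypy (uFormGroup (Fin 2) (Fin 1)) (cmArchSectionUForm L ι H T hT)) :
    Literature.NumberTheory.Rogawski1990.hodgeTypeRigid :=
  hodgeTypeRigid_of_cohArchComponentRigid hβ
    (fun L _ _ _ ι H T hT μ _ P hP => hF1a L ι H T hT μ P (Or.inl hP))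
    (fun L _ _ _ ι H T hT μ _ P hP => hF1a L ι H T hT μ P (Or.inr hP))
    hVal_hol hVal_antihol

/-- **E2′₀ OUTRIGHT MODULO F1a: no discrete automorphic `P` of `U(H)` is of both holomorphic and antiholomorphic cotangent type at `ι`.**
For every CM frame (`H` definite away from `ι`, `[L⁺:ℚ] ≥ 2`), every automorphic `μ` and every discrete `P`, given `StubF1aCM` (letter F1a
★ `DiscreteAutomorphicRep.ArchIsotypy` at the pin): `P.IsHolCotangentAt → P.IsAntiholCotangentAt → False` — ★
`F0P3HodgeTypeRigidDiag.not_isHol_isAntihol_of_valueMaps` (T6a on the detecting irreducible module, ★ S0∕S2∕S3) with both value-map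
heads discharged by ★ `hVal_hol` ∕ `hVal_antihol` (B1′).  No use of β: this is the diagonal `P = P′` of E2′.
[cite: Rogawski1990, §15.3 ¶1; Prop. 15.2.1 (b)] [cite: BorelWallach2000, VI Thm. 4.11] [cite: FlathCorvallis1979, Thm. 3] -/
theorem not_isHol_isAntihol_of_F1a
    (hF1a : ∀ (L : Type) [Field L] [NumberField L] [IsCMField L] (ι : L →+* ℂ) (H : Matrix (Fin 3) (Fin 3) L) (T : GL (Fin 3) ℂ)
      (hT : (T : Matrix (Fin 3) (Fin 3) ℂ)ᴴ * H.map ι * (T : Matrix (Fin 3) (Fin 3) ℂ) = Literature.Geometry.ComplexHyperbolic.BallModel.J)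
      (μ : Measure (adelicGroupData (↥(maximalRealSubfield L)) L (IsCMField.complexConj L) 3 H).automorphicQuotient)
      [(adelicGroupData (↥(maximalRealSubfield L)) L (IsCMField.complexConj L) 3 H).IsAutomorphicMeasure μ]
      (P : DiscreteAutomorphicRep (adelicGroupData (↥(maximalRealSubfield L)) L (IsCMField.complexConj L) 3 H) μ),
      (P.IsHolCotangentAt (cmArchSection L ι H T hT) (cmCompactFactor L ι H T hT) ∨
        P.IsAntiholCotangentAt (cmArchSection L ι H T hT) (cmCompactFactor L ι H T hT)) →
      P.ArchIsotypy (uFormGroup (Fin 2) (Fin 1)) (cmArchSectionUForm L ι H T hT)) :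
    ∀ (L : Type) [Field L] [NumberField L] [IsCMField L] (ι : L →+* ℂ) (H : Matrix (Fin 3) (Fin 3) L) (T : GL (Fin 3) ℂ)
      (hT : (T : Matrix (Fin 3) (Fin 3) ℂ)ᴴ * H.map ι * (T : Matrix (Fin 3) (Fin 3) ℂ) = Literature.Geometry.ComplexHyperbolic.BallModel.J),
      (∀ τ' : L →+* ℂ, InfinitePlace.mk τ' ≠ InfinitePlace.mk ι → (H.map τ').PosDef) →
      2 ≤ Module.finrank ℚ ↥(maximalRealSubfield L) →
      ∀ (μ : Measure (adelicGroupData (↥(maximalRealSubfield L)) L (IsCMField.complexConj L) 3 H).automorphicQuotient)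
        [(adelicGroupData (↥(maximalRealSubfield L)) L (IsCMField.complexConj L) 3 H).IsAutomorphicMeasure μ]
        (P : DiscreteAutomorphicRep (adelicGroupData (↥(maximalRealSubfield L)) L (IsCMField.complexConj L) 3 H) μ),
        P.IsHolCotangentAt (cmArchSection L ι H T hT) (cmCompactFactor L ι H T hT) →
          P.IsAntiholCotangentAt (cmArchSection L ι H T hT) (cmCompactFactor L ι H T hT) → False :=
  fun L _ _ _ ι H T hT hdef h2 μ _ P hP hP' =>
    not_isHol_isAntihol_of_valueMaps ι T hT P (hF1a L ι H T hT μ P (Or.inl hP)) (hVal_hol L ι H T hT hdef h2 μ P)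
      (hVal_antihol L ι H T hT hdef h2 μ P) hP hP'

end Summit.HodgeConjecture.HodgeConjecture.Cruxes.H413.F0P3StubE2pFold

end

/-! ## §2 CONTRACT v5 (line ed. 2.4, F0P3-plan (g2) ruling 2026-08-31T02:42:48Z): the same closers with `StubF1aCM` carrying the datum's
standing hypotheses `hdef`, `h2` (compact quotient) — appended by F0P3-p01 (g4); §1 above byte-identical to ★ p801320. -/

noncomputable section

namespace Summit.HodgeConjecture.HodgeConjecture.Cruxes.H413.F0P3StubE2pFold

open NumberField NumberField.InfinitePlace MeasureTheory
open scoped Matrix MatrixGroups ComplexOrder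
open Literature.RepresentationTheory.BorelWallach2000
open Literature.NumberTheory.Automorphic Literature.NumberTheory.Automorphic.UnitaryGroup
open Literature.NumberTheory.Automorphic.UnitaryGroup.CotangentForms
open Literature.RepresentationTheory.KonnoKonno2007 Literature.RepresentationTheory.KonnoKonno2007.RealDualPair
open Literature.RepresentationTheory.KonnoKonno2007.RealDualPair.UForm
open Summit.HodgeConjecture.HodgeConjecture.Cruxes.H413.F0P3HodgeTypeRigidOfArchRigid
open Summit.HodgeConjecture.HodgeConjecture.Cruxes.H413.F0P3HodgeTypeRigidDiag
open Summit.HodgeConjecture.HodgeConjecture.Cruxes.H413.F0P3ValueMapHeads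
open Summit.HodgeConjecture.HodgeConjecture.Cruxes.H413.F0P3ArchIsotypyCM
open Summit.HodgeConjecture.HodgeConjecture.Cruxes.H413.F0P3ValueMapTransport
open Summit.HodgeConjecture.HodgeConjecture.Cruxes.H413.F0P3PNullMapIsCocycle
open Summit.HodgeConjecture.HodgeConjecture.Cruxes.H413.F0P3bArchDegOnePackage

/-- **E2′ ⇐ β + F1a (COMPACT-QUOTIENT form of the F1a hypotheses).**  Identical to ★
`F0P3HodgeTypeRigidOfArchRigid.hodgeTypeRigid_of_cohArchComponentRigid` (proof verbatim) except that the two F1a hypotheses `hF1a` (hol) and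
`hF1a'` (antihol) carry the datum's standing hypotheses `hdef : ∀ τ', mk τ' ≠ mk ι → (H.map τ').PosDef` and `h2 : 2 ≤ [L⁺:ℚ]` after `hT`
(CONTRACT v5): the letter `hodgeTypeRigid` quantifies them, so they are in scope where F1a is applied.  [cite: Rogawski1990, Thm. 13.3.6 (c);
Thm. 13.3.5; §14.6 Thm. 14.6.4; §12.3 p. 174; Prop. 15.2.1; §15.3 ¶1] [cite: BorelWallach2000, VI Thm. 4.11] [cite: FlathCorvallis1979, Thm. 3] -/
theorem hodgeTypeRigid_of_cohArchComponentRigid_cpt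
    (hβ : ∀ (L : Type) [Field L] [NumberField L] [IsCMField L] (ι : L →+* ℂ) (H : Matrix (Fin 3) (Fin 3) L) (T : GL (Fin 3) ℂ)
      (hT : (T : Matrix (Fin 3) (Fin 3) ℂ)ᴴ * H.map ι * (T : Matrix (Fin 3) (Fin 3) ℂ) = Literature.Geometry.ComplexHyperbolic.BallModel.J),
      (∀ τ' : L →+* ℂ, InfinitePlace.mk τ' ≠ InfinitePlace.mk ι → (H.map τ').PosDef) →
      2 ≤ Module.finrank ℚ ↥(maximalRealSubfield L) →
      ∀ (μ : Measure (adelicGroupData (↥(maximalRealSubfield L)) L (IsCMField.complexConj L) 3 H).automorphicQuotient)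
        [(adelicGroupData (↥(maximalRealSubfield L)) L (IsCMField.complexConj L) 3 H).IsAutomorphicMeasure μ]
        (W : Type) [AddCommGroup W] [Module ℂ W]
        (σ : Representation ℂ (finAdelic (↥(maximalRealSubfield L)) L (IsCMField.complexConj L) 3 H) W),
        σ.IsIrreducible → σ.IsSmooth →
      ∀ (P P' : DiscreteAutomorphicRep (adelicGroupData (↥(maximalRealSubfield L)) L (IsCMField.complexConj L) 3 H) μ),
        P.HasFinComponent σ → P'.HasFinComponent σ →
      ∀ (M : Type) [AddCommGroup M] [Module ℂ M] (σK : Representation ℂ (uFormGroup (Fin 2) (Fin 1)).maximalCompact M)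
        (σ𝔤 : (uFormGroup (Fin 2) (Fin 1)).lie →ₗ⁅ℝ⁆ Module.End ℂ M) (hM : IsGKModule (uFormGroup (Fin 2) (Fin 1)) σK σ𝔤),
        IsIrreducibleGK σK σ𝔤 →
        (∃ T₁ : P.archModuleCM ι T hT →ₗ[ℂ] M,
          (∀ (k : (uFormGroup (Fin 2) (Fin 1)).maximalCompact) (w : P.archModuleCM ι T hT),
              T₁ (P.archRepKCM ι T hT k w) = σK k (T₁ w)) ∧
            (∀ (X : (uFormGroup (Fin 2) (Fin 1)).lie) (w : P.archModuleCM ι T hT),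
              T₁ (P.archRepLieCM ι T hT X w) = σ𝔤 X (T₁ w)) ∧ T₁ ≠ 0) →
      ∀ (M' : Type) [AddCommGroup M'] [Module ℂ M'] (σK' : Representation ℂ (uFormGroup (Fin 2) (Fin 1)).maximalCompact M')
        (σ𝔤' : (uFormGroup (Fin 2) (Fin 1)).lie →ₗ⁅ℝ⁆ Module.End ℂ M') (hM' : IsGKModule (uFormGroup (Fin 2) (Fin 1)) σK' σ𝔤'),
        IsIrreducibleGK σK' σ𝔤' →
        (∃ T₂ : P'.archModuleCM ι T hT →ₗ[ℂ] M',
          (∀ (k : (uFormGroup (Fin 2) (Fin 1)).maximalCompact) (w : P'.archModuleCM ι T hT),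
              T₂ (P'.archRepKCM ι T hT k w) = σK' k (T₂ w)) ∧
            (∀ (X : (uFormGroup (Fin 2) (Fin 1)).lie) (w : P'.archModuleCM ι T hT),
              T₂ (P'.archRepLieCM ι T hT X w) = σ𝔤' X (T₂ w)) ∧ T₂ ≠ 0) →
      ∀ (δ δ' : ℤ), (δ = 1 ∨ δ = -1) → (δ' = 1 ∨ δ' = -1) →
        upqTypeClasses σK σ𝔤 hM.ad_compat 1 δ ≠ ⊥ → upqTypeClasses σK' σ𝔤' hM'.ad_compat 1 δ' ≠ ⊥ →
        AreGKEquivalent σK σ𝔤 σK' σ𝔤')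
    (hF1a : ∀ (L : Type) [Field L] [NumberField L] [IsCMField L] (ι : L →+* ℂ) (H : Matrix (Fin 3) (Fin 3) L) (T : GL (Fin 3) ℂ)
      (hT : (T : Matrix (Fin 3) (Fin 3) ℂ)ᴴ * H.map ι * (T : Matrix (Fin 3) (Fin 3) ℂ) = Literature.Geometry.ComplexHyperbolic.BallModel.J),
      (∀ τ' : L →+* ℂ, InfinitePlace.mk τ' ≠ InfinitePlace.mk ι → (H.map τ').PosDef) →
      2 ≤ Module.finrank ℚ ↥(maximalRealSubfield L) →
      ∀ (μ : Measure (adelicGroupData (↥(maximalRealSubfield L)) L (IsCMField.complexConj L) 3 H).automorphicQuotient)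
      [(adelicGroupData (↥(maximalRealSubfield L)) L (IsCMField.complexConj L) 3 H).IsAutomorphicMeasure μ]
      (P : DiscreteAutomorphicRep (adelicGroupData (↥(maximalRealSubfield L)) L (IsCMField.complexConj L) 3 H) μ),
      P.IsHolCotangentAt (cmArchSection L ι H T hT) (cmCompactFactor L ι H T hT) →
      P.ArchIsotypy (uFormGroup (Fin 2) (Fin 1)) (cmArchSectionUForm L ι H T hT))
    (hF1a' : ∀ (L : Type) [Field L] [NumberField L] [IsCMField L] (ι : L →+* ℂ) (H : Matrix (Fin 3) (Fin 3) L) (T : GL (Fin 3) ℂ)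
      (hT : (T : Matrix (Fin 3) (Fin 3) ℂ)ᴴ * H.map ι * (T : Matrix (Fin 3) (Fin 3) ℂ) = Literature.Geometry.ComplexHyperbolic.BallModel.J),
      (∀ τ' : L →+* ℂ, InfinitePlace.mk τ' ≠ InfinitePlace.mk ι → (H.map τ').PosDef) →
      2 ≤ Module.finrank ℚ ↥(maximalRealSubfield L) →
      ∀ (μ : Measure (adelicGroupData (↥(maximalRealSubfield L)) L (IsCMField.complexConj L) 3 H).automorphicQuotient)
      [(adelicGroupData (↥(maximalRealSubfield L)) L (IsCMField.complexConj L) 3 H).IsAutomorphicMeasure μ]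
      (P : DiscreteAutomorphicRep (adelicGroupData (↥(maximalRealSubfield L)) L (IsCMField.complexConj L) 3 H) μ),
      P.IsAntiholCotangentAt (cmArchSection L ι H T hT) (cmCompactFactor L ι H T hT) →
      P.ArchIsotypy (uFormGroup (Fin 2) (Fin 1)) (cmArchSectionUForm L ι H T hT))
    (hVal : ∀ (L : Type) [Field L] [NumberField L] [IsCMField L] (ι : L →+* ℂ) (H : Matrix (Fin 3) (Fin 3) L) (T : GL (Fin 3) ℂ)
      (hT : (T : Matrix (Fin 3) (Fin 3) ℂ)ᴴ * H.map ι * (T : Matrix (Fin 3) (Fin 3) ℂ) = Literature.Geometry.ComplexHyperbolic.BallModel.J),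
      (∀ τ' : L →+* ℂ, InfinitePlace.mk τ' ≠ InfinitePlace.mk ι → (H.map τ').PosDef) →
      2 ≤ Module.finrank ℚ ↥(maximalRealSubfield L) →
      ∀ (μ : Measure (adelicGroupData (↥(maximalRealSubfield L)) L (IsCMField.complexConj L) 3 H).automorphicQuotient)
      [(adelicGroupData (↥(maximalRealSubfield L)) L (IsCMField.complexConj L) 3 H).IsAutomorphicMeasure μ]
      (P : DiscreteAutomorphicRep (adelicGroupData (↥(maximalRealSubfield L)) L (IsCMField.complexConj L) 3 H) μ)
      (Φ : (adelicGroupData (↥(maximalRealSubfield L)) L (IsCMField.complexConj L) 3 H).Adelic → (Fin 2 → ℂ)),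
      Φ ∈ CotangentForms.holCotForms (↥(maximalRealSubfield L)) L (IsCMField.complexConj L) 3 H (cmArchSection L ι H T hT)
        (cmCompactFactor L ι H T hT) → Φ ≠ 0 → P.ContainsForm Φ →
      ∃ φ : (uFormGroup (Fin 2) (Fin 1)).lie →ₗ[ℝ] P.archModuleCM ι T hT, φ ≠ 0 ∧
        (∀ W ∈ (uFormGroup (Fin 2) (Fin 1)).kInLie, φ W = 0) ∧
        (∀ (k : (uFormGroup (Fin 2) (Fin 1)).maximalCompact) (X : (uFormGroup (Fin 2) (Fin 1)).lie),
          P.archRepKCM ι T hT k (φ X) =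
            φ ((uFormGroup (Fin 2) (Fin 1)).Ad (Subgroup.inclusion (uFormGroup (Fin 2) (Fin 1)).maximalCompact_le_carrier k) X)) ∧
        (∀ W ∈ (uFormGroup (Fin 2) (Fin 1)).kInLie, ∀ X : (uFormGroup (Fin 2) (Fin 1)).lie,
          φ ⁅W, X⁆ = P.archRepLieCM ι T hT W (φ X)) ∧
        (∀ X : (uFormGroup (Fin 2) (Fin 1)).lie, P.archRepLieCM ι T hT (upqZ0 (Fin 2) (Fin 1)) (φ X) = Complex.I • φ X) ∧
        (∀ (X : (uFormGroup (Fin 2) (Fin 1)).lie) (s : (Fin 2 × Fin 1) × Fin 2),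
          P.archRepLieCM ι T hT (upqPBasis s) (φ X) +
            Complex.I • P.archRepLieCM ι T hT ⁅upqZ0 (Fin 2) (Fin 1), upqPBasis s⁆ (φ X) = 0))
    (hVal' : ∀ (L : Type) [Field L] [NumberField L] [IsCMField L] (ι : L →+* ℂ) (H : Matrix (Fin 3) (Fin 3) L) (T : GL (Fin 3) ℂ)
      (hT : (T : Matrix (Fin 3) (Fin 3) ℂ)ᴴ * H.map ι * (T : Matrix (Fin 3) (Fin 3) ℂ) = Literature.Geometry.ComplexHyperbolic.BallModel.J),
      (∀ τ' : L →+* ℂ, InfinitePlace.mk τ' ≠ InfinitePlace.mk ι → (H.map τ').PosDef) →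
      2 ≤ Module.finrank ℚ ↥(maximalRealSubfield L) →
      ∀ (μ : Measure (adelicGroupData (↥(maximalRealSubfield L)) L (IsCMField.complexConj L) 3 H).automorphicQuotient)
      [(adelicGroupData (↥(maximalRealSubfield L)) L (IsCMField.complexConj L) 3 H).IsAutomorphicMeasure μ]
      (P : DiscreteAutomorphicRep (adelicGroupData (↥(maximalRealSubfield L)) L (IsCMField.complexConj L) 3 H) μ)
      (Ψ : (adelicGroupData (↥(maximalRealSubfield L)) L (IsCMField.complexConj L) 3 H).Adelic → (Fin 2 → ℂ)),
      Ψ ∈ (CotangentForms.holCotForms (↥(maximalRealSubfield L)) L (IsCMField.complexConj L) 3 H (cmArchSection L ι H T hT)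
        (cmCompactFactor L ι H T hT)).map (CotangentForms.conjFun (↥(maximalRealSubfield L)) L (IsCMField.complexConj L) 3 H) →
        Ψ ≠ 0 → P.ContainsForm Ψ →
      ∃ φ : (uFormGroup (Fin 2) (Fin 1)).lie →ₗ[ℝ] P.archModuleCM ι T hT, φ ≠ 0 ∧
        (∀ W ∈ (uFormGroup (Fin 2) (Fin 1)).kInLie, φ W = 0) ∧
        (∀ (k : (uFormGroup (Fin 2) (Fin 1)).maximalCompact) (X : (uFormGroup (Fin 2) (Fin 1)).lie),
          P.archRepKCM ι T hT k (φ X) =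
            φ ((uFormGroup (Fin 2) (Fin 1)).Ad (Subgroup.inclusion (uFormGroup (Fin 2) (Fin 1)).maximalCompact_le_carrier k) X)) ∧
        (∀ W ∈ (uFormGroup (Fin 2) (Fin 1)).kInLie, ∀ X : (uFormGroup (Fin 2) (Fin 1)).lie,
          φ ⁅W, X⁆ = P.archRepLieCM ι T hT W (φ X)) ∧
        (∀ X : (uFormGroup (Fin 2) (Fin 1)).lie, P.archRepLieCM ι T hT (upqZ0 (Fin 2) (Fin 1)) (φ X) = (-Complex.I) • φ X) ∧
        (∀ (X : (uFormGroup (Fin 2) (Fin 1)).lie) (s : (Fin 2 × Fin 1) × Fin 2),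
          P.archRepLieCM ι T hT (upqPBasis s) (φ X) +
            (-Complex.I) • P.archRepLieCM ι T hT ⁅upqZ0 (Fin 2) (Fin 1), upqPBasis s⁆ (φ X) = 0)) :
    Literature.NumberTheory.Rogawski1990.hodgeTypeRigid := by
  intro L _ _ _ ι H T hT hdef h2 μ _ W _ _ σ hirr hsm P P' hP hP' hfin hfin'
  -- letter F1a at the pin, for the hol-type `P` and the antihol-type `P′`
  have hIso := hF1a L ι H T hT hdef h2 μ P hP
  have hIso' := hF1a' L ι H T hT hdef h2 μ P' hP'
  -- the cotangent forms and their value maps (B1′)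
  obtain ⟨Φ, hΦ, hΦ0, hcont⟩ := hP
  obtain ⟨Ψ, hΨ, hΨ0, hcont'⟩ := hP'
  obtain ⟨φ, hφ0, h0, hK, h𝔨, hwt, hN⟩ := hVal L ι H T hT hdef h2 μ P Φ hΦ hΦ0 hcont
  obtain ⟨φ', hφ'0, h0', hK', h𝔨', hwt', hN'⟩ := hVal' L ι H T hT hdef h2 μ P' Ψ hΨ hΨ0 hcont'
  -- the detecting irreducible admissible modules (F1a unpacked at the pin) and detecting maps
  obtain ⟨M, _, _, σK, σ𝔤, hGK, hirrM, -, hdet⟩ := exists_detecting_irreducible ι T hT P hIso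
  obtain ⟨M', _, _, σK', σ𝔤', hGK', hirrM', -, hdet'⟩ := exists_detecting_irreducible ι T hT P' hIso'
  obtain ⟨X₀, hX₀⟩ := exists_apply_ne_zero_of_ne_zero hφ0
  obtain ⟨X₁, hX₁⟩ := exists_apply_ne_zero_of_ne_zero hφ'0
  obtain ⟨T₁, hT₁K, hT₁𝔤, hT₁⟩ := hdet _ hX₀
  obtain ⟨T₂, hT₂K, hT₂𝔤, hT₂⟩ := hdet' _ hX₁
  have hT₁0 : T₁ ≠ 0 := fun h => hT₁ (h ▸ rfl)
  have hT₂0 : T₂ ≠ 0 := fun h => hT₂ (h ▸ rfl)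
  -- typed value maps on `M`, `M′` and the cohomology classes they give
  have c1 : ((1 : ℤ) : ℂ) = 1 := Int.cast_one
  have c2 : ((-1 : ℤ) : ℂ) = -1 := by rw [Int.cast_neg, Int.cast_one]
  obtain ⟨q0, qK, q𝔨, qwt, qN⟩ := valueMap_comp (δ := 1) φ T₁ hT₁K hT₁𝔤 h0 hK h𝔨
    (fun X => eq_intCast_mul_I_smul_of_eq_one (V := ↥(P.archModuleCM ι T hT)) c1 (hwt X))
    (fun X s => add_intCast_mul_I_smul_eq_zero_of_eq_one (V := ↥(P.archModuleCM ι T hT)) c1 (hN X s))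
  obtain ⟨r0, rK, r𝔨, rwt, rN⟩ := valueMap_comp (δ := -1) φ' T₂ hT₂K hT₂𝔤 h0' hK' h𝔨'
    (fun X => eq_intCast_mul_I_smul_of_eq_neg_one (V := ↥(P'.archModuleCM ι T hT)) c2 (hwt' X))
    (fun X s => add_intCast_mul_I_smul_eq_zero_of_eq_neg_one (V := ↥(P'.archModuleCM ι T hT)) c2 (hN' X s))
  have hne : upqTypeClasses σK σ𝔤 hGK.ad_compat 1 1 ≠ ⊥ :=
    typeClasses_ne_bot_of_linearMap σK σ𝔤 hGK.ad_compat hirrM (Or.inl rfl) _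
      (comp_ne_zero_of_apply_ne_zero φ T₁ hT₁) q0 qK q𝔨 qwt qN
  have hne' : upqTypeClasses σK' σ𝔤' hGK'.ad_compat 1 (-1) ≠ ⊥ :=
    typeClasses_ne_bot_of_linearMap σK' σ𝔤' hGK'.ad_compat hirrM' (Or.inr rfl) _
      (comp_ne_zero_of_apply_ne_zero φ' T₂ hT₂) r0 rK r𝔨 rwt rN
  -- β: the two archimedean constituents are equivalent; T6a purity forbids it
  have he : AreGKEquivalent σK σ𝔤 σK' σ𝔤' :=
    hβ L ι H T hT hdef h2 μ W σ hirr hsm P P' hfin hfin' M σK σ𝔤 hGK hirrM ⟨T₁, hT₁K, hT₁𝔤, hT₁0⟩ M' σK' σ𝔤' hGK' hirrM'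
      ⟨T₂, hT₂K, hT₂𝔤, hT₂0⟩ 1 (-1) (Or.inl rfl) (Or.inr rfl) hne hne'
  exact hol_antihol_inequivalent_of_irreducible hGK hGK' hirrM' hne hne' he

/-- **`stub_E2p` CLOSER, CONTRACT v5: letter E2′ `hodgeTypeRigid` from letter β `cohArchComponentRigid` and `StubF1aCM` in its v5 text**
(F1a at the CM pin for hol-∕antihol-type `P` of a COMPACT-QUOTIENT datum: `hdef`, `h2` after `hT`).  Line fold (ed. 2.4):
`stub_E2p := hodgeTypeRigid_of_beta_cpt stub_beta stub_F1a_cm`. [cite: Rogawski1990, Thm. 13.3.6 (c); Thm. 13.3.5; §14.6 Thm. 14.6.4; §12.3 p. 174;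
Prop. 15.2.1; §15.3 ¶1] [cite: BorelWallach2000, VI Thm. 4.11] [cite: FlathCorvallis1979, Thm. 3] -/
theorem hodgeTypeRigid_of_beta_cpt (hβ : Literature.NumberTheory.Rogawski1990.cohArchComponentRigid)
    (hF1a : ∀ (L : Type) [Field L] [NumberField L] [IsCMField L] (ι : L →+* ℂ) (H : Matrix (Fin 3) (Fin 3) L) (T : GL (Fin 3) ℂ)
      (hT : (T : Matrix (Fin 3) (Fin 3) ℂ)ᴴ * H.map ι * (T : Matrix (Fin 3) (Fin 3) ℂ) = Literature.Geometry.ComplexHyperbolic.BallModel.J),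
      (∀ τ' : L →+* ℂ, InfinitePlace.mk τ' ≠ InfinitePlace.mk ι → (H.map τ').PosDef) →
      2 ≤ Module.finrank ℚ ↥(maximalRealSubfield L) →
      ∀ (μ : Measure (adelicGroupData (↥(maximalRealSubfield L)) L (IsCMField.complexConj L) 3 H).automorphicQuotient)
      [(adelicGroupData (↥(maximalRealSubfield L)) L (IsCMField.complexConj L) 3 H).IsAutomorphicMeasure μ]
      (P : DiscreteAutomorphicRep (adelicGroupData (↥(maximalRealSubfield L)) L (IsCMField.complexConj L) 3 H) μ),
      (P.IsHolCotangentAt (cmArchSection L ι H T hT) (cmCompactFactor L ι H T hT) ∨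
        P.IsAntiholCotangentAt (cmArchSection L ι H T hT) (cmCompactFactor L ι H T hT)) →
      P.ArchIsotypy (uFormGroup (Fin 2) (Fin 1)) (cmArchSectionUForm L ι H T hT)) :
    Literature.NumberTheory.Rogawski1990.hodgeTypeRigid :=
  hodgeTypeRigid_of_cohArchComponentRigid_cpt hβ
    (fun L _ _ _ ι H T hT hdef h2 μ _ P hP => hF1a L ι H T hT hdef h2 μ P (Or.inl hP))
    (fun L _ _ _ ι H T hT hdef h2 μ _ P hP => hF1a L ι H T hT hdef h2 μ P (Or.inr hP))
    hVal_hol hVal_antihol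

/-- **E2′₀ OUTRIGHT MODULO F1a (v5 text)**: no discrete automorphic `P` of a compact-quotient `U(H)` datum is of both holomorphic and
antiholomorphic cotangent type at `ι` — as ★ `not_isHol_isAntihol_of_F1a`, with `StubF1aCM` in its CONTRACT v5 text.
[cite: Rogawski1990, §15.3 ¶1; Prop. 15.2.1 (b)] [cite: BorelWallach2000, VI Thm. 4.11] [cite: FlathCorvallis1979, Thm. 3] -/
theorem not_isHol_isAntihol_of_F1a_cpt
    (hF1a : ∀ (L : Type) [Field L] [NumberField L] [IsCMField L] (ι : L →+* ℂ) (H : Matrix (Fin 3) (Fin 3) L) (T : GL (Fin 3) ℂ)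
      (hT : (T : Matrix (Fin 3) (Fin 3) ℂ)ᴴ * H.map ι * (T : Matrix (Fin 3) (Fin 3) ℂ) = Literature.Geometry.ComplexHyperbolic.BallModel.J),
      (∀ τ' : L →+* ℂ, InfinitePlace.mk τ' ≠ InfinitePlace.mk ι → (H.map τ').PosDef) →
      2 ≤ Module.finrank ℚ ↥(maximalRealSubfield L) →
      ∀ (μ : Measure (adelicGroupData (↥(maximalRealSubfield L)) L (IsCMField.complexConj L) 3 H).automorphicQuotient)
      [(adelicGroupData (↥(maximalRealSubfield L)) L (IsCMField.complexConj L) 3 H).IsAutomorphicMeasure μ]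
      (P : DiscreteAutomorphicRep (adelicGroupData (↥(maximalRealSubfield L)) L (IsCMField.complexConj L) 3 H) μ),
      (P.IsHolCotangentAt (cmArchSection L ι H T hT) (cmCompactFactor L ι H T hT) ∨
        P.IsAntiholCotangentAt (cmArchSection L ι H T hT) (cmCompactFactor L ι H T hT)) →
      P.ArchIsotypy (uFormGroup (Fin 2) (Fin 1)) (cmArchSectionUForm L ι H T hT)) :
    ∀ (L : Type) [Field L] [NumberField L] [IsCMField L] (ι : L →+* ℂ) (H : Matrix (Fin 3) (Fin 3) L) (T : GL (Fin 3) ℂ)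
      (hT : (T : Matrix (Fin 3) (Fin 3) ℂ)ᴴ * H.map ι * (T : Matrix (Fin 3) (Fin 3) ℂ) = Literature.Geometry.ComplexHyperbolic.BallModel.J),
      (∀ τ' : L →+* ℂ, InfinitePlace.mk τ' ≠ InfinitePlace.mk ι → (H.map τ').PosDef) →
      2 ≤ Module.finrank ℚ ↥(maximalRealSubfield L) →
      ∀ (μ : Measure (adelicGroupData (↥(maximalRealSubfield L)) L (IsCMField.complexConj L) 3 H).automorphicQuotient)
        [(adelicGroupData (↥(maximalRealSubfield L)) L (IsCMField.complexConj L) 3 H).IsAutomorphicMeasure μ]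
        (P : DiscreteAutomorphicRep (adelicGroupData (↥(maximalRealSubfield L)) L (IsCMField.complexConj L) 3 H) μ),
        P.IsHolCotangentAt (cmArchSection L ι H T hT) (cmCompactFactor L ι H T hT) →
          P.IsAntiholCotangentAt (cmArchSection L ι H T hT) (cmCompactFactor L ι H T hT) → False :=
  fun L _ _ _ ι H T hT hdef h2 μ _ P hP hP' =>
    not_isHol_isAntihol_of_valueMaps ι T hT P (hF1a L ι H T hT hdef h2 μ P (Or.inl hP)) (hVal_hol L ι H T hT hdef h2 μ P)
      (hVal_antihol L ι H T hT hdef h2 μ P) hP hP'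

end Summit.HodgeConjecture.HodgeConjecture.Cruxes.H413.F0P3StubE2pFold

end
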